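import Literature.AlgebraicGeometry.Resolution.Lipman1969ForwardBaseChangeHolds
import Literature.AlgebraicGeometry.Resolution.RationalSurfaceSingularitiesBasic
import Literature.AlgebraicGeometry.Morphisms.CechH1FaithfullyFlatDescent
import Literature.RingTheory.Flat.NormalityDescends
import Mathlib.RingTheory.Flat.FaithfullyFlat.Algebra
import HarnessLib

/-!
# Lipman 1969, Proposition (16.5), converse direction ("B normal ⇒ A normal",
# "B rational ⇒ A rational"), and the named fact `Lipman1969_16_5` from Proposition (1.2)

Topic: `Literature/AlgebraicGeometry/Resolution`.  The named fact `Lipman1969_16_5`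
(`Resolution/Lipman1969FormallySmoothBaseChange`; J. Lipman, *Rational singularities, with
applications to algebraic surfaces and unique factorization*, Publ. Math. IHÉS 36 (1969),
Prop. (16.5), p. 235) says, for `A`, `B` Noetherian local, `A → B` local and flat with `𝔪_A B = 𝔪_B`
and `κ(B)/κ(A)` separable algebraic, `A` reduced, `dim A = dim B = 2`, `Spec A` admitting a
desingularization: `A` is normal iff `B` is normal, and then `A` has a rational singularity iff `B`
has.  Its forward direction is the theorem `Lipman1969_16_5_forward`
(`Resolution/Lipman1969ForwardBaseChangeHolds`: `Lipman1969_16_5_normal_mp`,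
`Lipman1969_16_5_rational_mp`).  This file proves the CONVERSE direction:

* `Lipman1969_16_5_normal_mpr` — **"`B` normal ⇒ `A` normal"**, UNCONDITIONAL: a flat local
  homomorphism of local rings is faithfully flat (Mathlib `Module.FaithfullyFlat.of_flat_of_isLocalHom`)
  and normality descends along faithfully flat ring maps (`RingTheory/Flat/NormalityDescends`,
  Stacks 033G) — Lipman, proof of (16.3), p. 233: "Conversely if `B` is normal then so is `A`,
  since, by flatness, `A = B ∩ (field of fractions of A)`"; with the forward half,
  `Lipman1969_16_5_normal_iff`;
* `Lipman1969_16_5_rational_mpr_of_1_2` — **"`B` rational ⇒ `A` rational"** for `A` normal,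
  CONDITIONAL on the named fact `Lipman1969_1_2` (Prop. (1.2)), following the printed proof
  (p. 235): for the given desingularization `g : Y → Spec A`, `g_B : Z = Y ×_A Spec B → Spec B` is a
  desingularization of the normal ring `B` (Lemma (16.1) (ii), the theorem
  `Lipman1969_16_1_ii_holds`; `B` normal by the forward half), so "`H¹(Y, 𝒪_Y) ⊗_A B = H¹(Z, 𝒪_Z) = 0`
  (Proposition (1.2)) and since `B` is faithfully flat over `A`, `H¹(Y, 𝒪_Y) = 0`" — Prop. (1.2) 2)
  in the form `Lipman1969_1_2.hasTrivialCechH1_of_isResolution`, and faithfully flat DESCENT of the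
  vanishing of Čech `H¹` (`Morphisms/CechH1FaithfullyFlatDescent`, packaged here as
  `HasTrivialCechH1.of_isPullback_of_faithfullyFlat` / `.of_pullback_snd_of_faithfullyFlat` /
  `.pullback_snd_iff_of_faithfullyFlat`).  (Lipman's induction over quadratic transformations,
  pp. 235–236, builds a desingularization of `A`; here one is given by hypothesis, so only its first
  step is needed.)
* `Lipman1969_16_5_of_1_2 : Lipman1969_1_2 → Lipman1969_16_5` — **the named fact (16.5) follows
  from the named fact (1.2)** (both directions assembled).

HONEST STATUS: `Lipman1969_16_5` is NOT discharged outright — it is reduced to `Lipman1969_1_2`,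
whose part 2) rests on the elimination of indeterminacies (Lipman, Thm. (26.1)) and is not proved in
the tree.  No new definitions; no new named facts; no summit statement is proved here; resolution
of singularities in dimension `≥ 4` / characteristic `p` is NOT proved here.

## References

* J. Lipman, *Rational singularities, with applications to algebraic surfaces and unique
  factorization*, Publ. Math. IHÉS 36 (1969) 195–279: Prop. (16.5), p. 235 (proof pp. 235–236);
  Prop. (16.3), p. 233 (normality, first lines of the proof); Lemma (16.1) (ii), p. 231;
  Prop. (1.2), p. 199; Def. (1.1), p. 199. [Lipman1969]
* The Stacks Project, Tag 02KH (flat base change of cohomology); Tag 033G (normality descends);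
  Tag 00HP / 058G (faithful flatness reflects exactness). [StacksProject]
-/

noncomputable section

open CategoryTheory CategoryTheory.Limits AlgebraicGeometry TopologicalSpace IsLocalRing
open Literature.AlgebraicGeometry.Morphisms

universe u

namespace Literature.AlgebraicGeometry.Resolution

/-! ## `H¹(X, 𝒪_X) = 0` descends along faithfully flat base change of the affine base -/

/-- **`H¹ = 0` descends along faithfully flat base change** (`HasTrivialCechH1` form): for a
cartesian square `Z = X ×_{Spec A} Spec B` with `A → B` faithfully flat and `X` quasi-separated,
`H¹(Z, 𝒪_Z) = 0` implies `H¹(X, 𝒪_X) = 0` (Čech `Ȟ¹` of every finite affine open cover: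
`H¹(Z, 𝒪_Z) = H¹(X, 𝒪_X) ⊗_A B` and `B` is faithfully flat).
[cite: StacksProject, Tag 02KH (Cohomology of Schemes, Lemma 30.5.2: flat base change)] -/
theorem HasTrivialCechH1.of_isPullback_of_faithfullyFlat {A B : Type u} [CommRing A] [CommRing B]
    [Algebra A B] [Module.FaithfullyFlat A B] {X Z : Scheme.{u}} {fX : X ⟶ Spec (.of A)}
    {fZ : Z ⟶ Spec (.of B)} {g : Z ⟶ X}
    (H : IsPullback g fZ fX (Spec.map (CommRingCat.ofHom (algebraMap A B))))
    [QuasiSeparatedSpace X] (hZ : HasTrivialCechH1 fZ) : HasTrivialCechH1 fX :=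
  fun _ _ U hU hUcov => subsingleton_cechH1_of_isPullback_of_faithfullyFlat fX fZ g U H hZ hU hUcov

/-- **`H¹ = 0` descends along faithfully flat base change**, for Mathlib's chosen pullback: if
`f : X → Spec A` is quasi-separated, `A → B` is faithfully flat and `X ×_{Spec A} Spec B → Spec B`
has `H¹ = 0`, then `H¹(X, 𝒪_X) = 0`.
[cite: StacksProject, Tag 02KH (Cohomology of Schemes, Lemma 30.5.2: flat base change)] -/
theorem HasTrivialCechH1.of_pullback_snd_of_faithfullyFlat {A B : Type u} [CommRing A]
    [CommRing B] [Algebra A B] [Module.FaithfullyFlat A B] {X : Scheme.{u}}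
    (f : X ⟶ Spec (.of A)) [QuasiSeparated f]
    (h : HasTrivialCechH1 (pullback.snd f (Spec.map (CommRingCat.ofHom (algebraMap A B))))) :
    HasTrivialCechH1 f := by
  haveI : QuasiSeparatedSpace X := quasiSeparatedSpace_of_quasiSeparated f
  exact HasTrivialCechH1.of_isPullback_of_faithfullyFlat (IsPullback.of_hasPullback f _) h

/-- **`H¹ = 0` is invariant under faithfully flat base change of the affine base**: for
`f : X → Spec A` quasi-compact quasi-separated and `A → B` faithfully flat,
`H¹(X ×_{Spec A} Spec B, 𝒪) = 0 ↔ H¹(X, 𝒪_X) = 0` (descent, this file; ascent,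
`HasTrivialCechH1.pullback_snd_of_flat`).
[cite: StacksProject, Tag 02KH (Cohomology of Schemes, Lemma 30.5.2: flat base change)] -/
theorem HasTrivialCechH1.pullback_snd_iff_of_faithfullyFlat {A B : Type u} [CommRing A]
    [CommRing B] [Algebra A B] [Module.FaithfullyFlat A B] {X : Scheme.{u}}
    (f : X ⟶ Spec (.of A)) [QuasiCompact f] [QuasiSeparated f] :
    HasTrivialCechH1 (pullback.snd f (Spec.map (CommRingCat.ofHom (algebraMap A B)))) ↔
      HasTrivialCechH1 f :=
  ⟨HasTrivialCechH1.of_pullback_snd_of_faithfullyFlat f, HasTrivialCechH1.pullback_snd_of_flat f⟩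

/-! ## Proposition (16.5), "B normal ⇒ A normal" (unconditional) -/

/-- **Lipman 1969, Proposition (16.5), "`B` normal ⇒ `A` normal"** (unconditional), with the
binders of `Lipman1969_16_5` verbatim: for `A`, `B` Noetherian local, `A → B` local and flat (hence
FAITHFULLY flat), if `B` is an integrally closed domain then so is `A` — `A → B` is injective and
normality descends along faithfully flat ring maps (Stacks 033G: an element of `Frac A` integral
over `A` lies in `B`, and `sB ∩ A = sA`); Lipman, proof of (16.3), p. 233: "Conversely if `B` is
normal then so is `A`, since, by flatness, `A = B ∩ (field of fractions of A)`".  Only flatness and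
locality of `A → B` are used; the other hypotheses are carried unused, as in the source.
[cite: Lipman1969, Proposition (16.5) (p. 235) and Proposition (16.3), proof (p. 233)] -/
theorem Lipman1969_16_5_normal_mpr :
    ∀ (A B : Type u) [CommRing A] [CommRing B] [IsNoetherianRing A] [IsNoetherianRing B]
    [IsLocalRing A] [IsLocalRing B] [Algebra A B] [IsLocalHom (algebraMap A B)] [Module.Flat A B],
    IsReduced A →
    (maximalIdeal A).map (algebraMap A B) = maximalIdeal B →
    Algebra.IsSeparable (ResidueField A) (ResidueField B) →
    ringKrullDim A = 2 → ringKrullDim B = 2 →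
    (∃ (Y : Scheme.{u}) (g : Y ⟶ Spec (.of A)), IsResolution g) →
      (IsDomain B ∧ IsIntegrallyClosed B) → (IsDomain A ∧ IsIntegrallyClosed A) := by
  intro A B _ _ _ _ _ _ _ _ _ _ _ _ _ _ _ hB
  obtain ⟨hdB, hicB⟩ := hB
  haveI : Module.FaithfullyFlat A B := Module.FaithfullyFlat.of_flat_of_isLocalHom
  exact ⟨Literature.RingTheory.Flat.isDomain_of_faithfullyFlat A B,
    Literature.RingTheory.Flat.isIntegrallyClosed_of_faithfullyFlat A B⟩

/-- **Lipman 1969, Proposition (16.5), normality clause** (unconditional IFF), with the binders of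
`Lipman1969_16_5` verbatim: "If either one of `A` or `B` is normal then so is the other"
(`Lipman1969_16_5_normal_mp` and `Lipman1969_16_5_normal_mpr`).
[cite: Lipman1969, Proposition (16.5) (p. 235)] -/
theorem Lipman1969_16_5_normal_iff :
    ∀ (A B : Type u) [CommRing A] [CommRing B] [IsNoetherianRing A] [IsNoetherianRing B]
    [IsLocalRing A] [IsLocalRing B] [Algebra A B] [IsLocalHom (algebraMap A B)] [Module.Flat A B],
    IsReduced A →
    (maximalIdeal A).map (algebraMap A B) = maximalIdeal B →
    Algebra.IsSeparable (ResidueField A) (ResidueField B) →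
    ringKrullDim A = 2 → ringKrullDim B = 2 →
    (∃ (Y : Scheme.{u}) (g : Y ⟶ Spec (.of A)), IsResolution g) →
      ((IsDomain A ∧ IsIntegrallyClosed A) ↔ (IsDomain B ∧ IsIntegrallyClosed B)) :=
  fun A B _ _ _ _ _ _ _ _ _ hred hmax hsep hdA hdB hY =>
    ⟨Lipman1969_16_5_normal_mp A B hred hmax hsep hdA hdB hY,
      Lipman1969_16_5_normal_mpr A B hred hmax hsep hdA hdB hY⟩

/-! ## Proposition (16.5), "B rational ⇒ A rational" (modulo Proposition (1.2)) -/

/-- **Lipman 1969, Proposition (16.5), "`B` rational ⇒ `A` rational"** (for `A` normal), with the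
binders of `Lipman1969_16_5` verbatim, CONDITIONAL on Prop. (1.2) (`h12 : Lipman1969_1_2`).  Proof
(p. 235): let `g : Y → Spec A` be the given desingularization; `B` is normal (forward half) and
`g_B : Y ×_A Spec B → Spec B` is a desingularization of `B` (Lemma (16.1) (ii),
`Lipman1969_16_1_ii_holds`), so `H¹(Y ×_A Spec B, 𝒪) = 0` by Prop. (1.2) 2) applied to the rational
`B` (`Lipman1969_1_2.hasTrivialCechH1_of_isResolution`); and `H¹(Y, 𝒪_Y) ⊗_A B = H¹(Y ×_A Spec B, 𝒪)`
with `B` faithfully flat over `A` (flat local), so `H¹(Y, 𝒪_Y) = 0`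
(`HasTrivialCechH1.of_pullback_snd_of_faithfullyFlat`): `A` has a rational singularity.
[cite: Lipman1969, Proposition (16.5) (p. 235, proof pp. 235–236)] -/
theorem Lipman1969_16_5_rational_mpr_of_1_2 (h12 : Lipman1969_1_2.{u}) :
    ∀ (A B : Type u) [CommRing A] [CommRing B] [IsNoetherianRing A] [IsNoetherianRing B]
    [IsLocalRing A] [IsLocalRing B] [Algebra A B] [IsLocalHom (algebraMap A B)] [Module.Flat A B],
    IsReduced A →
    (maximalIdeal A).map (algebraMap A B) = maximalIdeal B →
    Algebra.IsSeparable (ResidueField A) (ResidueField B) →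
    ringKrullDim A = 2 → ringKrullDim B = 2 →
    (∃ (Y : Scheme.{u}) (g : Y ⟶ Spec (.of A)), IsResolution g) →
      (IsDomain A ∧ IsIntegrallyClosed A) → HasRationalSingularity B → HasRationalSingularity A := by
  intro A B _ _ _ _ _ _ _ _ _ hred hmax hsep hdA hdB hY hA hB
  obtain ⟨Y, g, hg⟩ := hY
  -- `B` is normal (forward half of the normality clause)
  obtain ⟨hdB', hicB⟩ := Lipman1969_16_5_normal_mp A B hred hmax hsep hdA hdB ⟨Y, g, hg⟩ hA
  haveI := hdB'
  haveI := hicB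
  -- `g_B : Y ×_A Spec B → Spec B` is a desingularization of `B` (Lemma (16.1) (ii))
  obtain ⟨-, hres⟩ := Lipman1969_16_1_ii_holds A B hred hmax hsep Y g hg
  -- `H¹(Y ×_A Spec B, 𝒪) = 0` by Proposition (1.2) 2) for the rational `B`
  have hZ := Lipman1969_1_2.hasTrivialCechH1_of_isResolution h12 hdB hB _ hres
  -- faithfully flat descent of `H¹ = 0`
  haveI : IsProper g := hg.isProper
  haveI : Module.FaithfullyFlat A B := Module.FaithfullyFlat.of_flat_of_isLocalHom
  exact ⟨Y, g, hg, HasTrivialCechH1.of_pullback_snd_of_faithfullyFlat g hZ⟩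

/-- **Lipman 1969, Proposition (16.5), rationality clause** (IFF, for `A` normal), with the
binders of `Lipman1969_16_5` verbatim, conditional on Prop. (1.2) for the converse:
`A` has a rational singularity iff `B` has (`Lipman1969_16_5_rational_mp`,
`Lipman1969_16_5_rational_mpr_of_1_2`). [cite: Lipman1969, Proposition (16.5) (p. 235)] -/
theorem Lipman1969_16_5_rational_iff_of_1_2 (h12 : Lipman1969_1_2.{u}) :
    ∀ (A B : Type u) [CommRing A] [CommRing B] [IsNoetherianRing A] [IsNoetherianRing B]
    [IsLocalRing A] [IsLocalRing B] [Algebra A B] [IsLocalHom (algebraMap A B)] [Module.Flat A B],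
    IsReduced A →
    (maximalIdeal A).map (algebraMap A B) = maximalIdeal B →
    Algebra.IsSeparable (ResidueField A) (ResidueField B) →
    ringKrullDim A = 2 → ringKrullDim B = 2 →
    (∃ (Y : Scheme.{u}) (g : Y ⟶ Spec (.of A)), IsResolution g) →
      (IsDomain A ∧ IsIntegrallyClosed A) →
        (HasRationalSingularity A ↔ HasRationalSingularity B) :=
  fun A B _ _ _ _ _ _ _ _ _ hred hmax hsep hdA hdB hY hA =>
    ⟨Lipman1969_16_5_rational_mp A B hred hmax hsep hdA hdB hY hA,
      Lipman1969_16_5_rational_mpr_of_1_2 h12 A B hred hmax hsep hdA hdB hY hA⟩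

/-! ## The named fact (16.5) from the named fact (1.2) -/

/-- **Lipman 1969, Proposition (16.5), from Proposition (1.2)**: the named fact `Lipman1969_16_5`
("if either one of `A` or `B` is normal then so is the other, and then `A` has a rational
singularity if and only if `B` has a rational singularity", in the setting of `Lipman1969_16_1_ii`
with `dim A = dim B = 2`) FOLLOWS from the named fact `Lipman1969_1_2` (Prop. (1.2)): the normality
clause unconditionally (`Lipman1969_16_5_normal_iff`), "`A` rational ⇒ `B` rational" by
Lemma (16.1) (ii) and flat base change of `H¹` (`Lipman1969_16_5_rational_mp`), "`B` rational ⇒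
`A` rational" by Prop. (1.2) 2) and faithfully flat descent of `H¹`
(`Lipman1969_16_5_rational_mpr_of_1_2`) — the printed proof, pp. 235–236.  Consumers holding
`(h12 : Lipman1969_1_2)` obtain `Lipman1969_16_5` as `Lipman1969_16_5_of_1_2 h12`.
[cite: Lipman1969, Proposition (16.5) (p. 235, proof pp. 235–236)] -/
theorem Lipman1969_16_5_of_1_2 (h12 : Lipman1969_1_2.{u}) : Lipman1969_16_5.{u} :=
  fun A B _ _ _ _ _ _ _ _ _ hred hmax hsep hdA hdB hY =>
    ⟨Lipman1969_16_5_normal_iff A B hred hmax hsep hdA hdB hY,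
      Lipman1969_16_5_rational_iff_of_1_2 h12 A B hred hmax hsep hdA hdB hY⟩

/-- CONSUMER SHAPE CHECK (proved): at universe `0`, where the W4.4 facts bundles carry
`Lipman1969_1_2.{0}` as a conjunct, the conjunct `Lipman1969_16_5.{0}` is supplied by one token. -/
example (h12 : Lipman1969_1_2.{0}) : Lipman1969_16_5.{0} := Lipman1969_16_5_of_1_2 h12

end Literature.AlgebraicGeometry.Resolution

end
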